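import Mathlib
import HarnessLib
import Summits.HubbardSuperconductivity.HubbardSuperconductivity.Theorems.KLProgrammeKLRegimeEngineTwoLegStepV17F2ClosersGQ
import Summits.HubbardSuperconductivity.HubbardSuperconductivity.Theorems.KLProgrammeKLRegimeSplitTwoLegGridScale

/-!
# K3 gen 8, ENGINE child `KLRegimeEngineV17F2` (stmt-HubbardSuperconductivity-20437), stub (e) `stub_twoLeg_step`: the closer shell with residual B
# in GRID-MOMENT currency — TWO pinned weighted sums of the two-leg grid kernel of the scale-`n` one-shot grid action at the flow frame `K_n`

Cell gate-hubbard-kl, seat hubbard-kl-r2d-p1 (g6).  After `…EngineTwoLegStepV17F2ClosersGQ` (p534923) stub (e)'s open content on the registered bytes is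
{A1 = stub (C) (a hypothesis of (e)); B = the SIZES `|z_n(K_n) − 1| ≤ Z·U²` on the shell and `‖∇ I_L[Re Σ_n(K_n) − K_n∘p]‖ ≤ S·U²` on the shell tube,
`Z, S ≤ 2^{10|11}e¹⁸κ₀⁴·klE3Acum R`; C1/C2 = the two two-volume legs}.  The scale-`n` grid bridge `…KLRegimeSplitTwoLegGridScale` (this seat) reads both
B-sizes off the grid element `W_n[K_n] − 𝒩_{K_n,4M}`, `W_n[K] = effAction (S_{4M}ᵀ C^K_{>Λ_n} S_{4M}) (V_{4M} + 𝒩_{K,4M})` — the representation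
`𝒱^{(n)}[K] − 𝒩_K = map S_{4M} (W_n[K] − 𝒩_{K,4M})` holding at every scale.  Hence:

* **`stub_twoLeg_step_of_gridMoments_GQ`** (package `(G, Q)` and thresholds as binders, exactly like `stub_twoLeg_step_of_engineSizes_GQ`): stub (e)'s
  literal binders + `hBt` (circular temporal first moment of `kernel₂ (W_n[K_n] − 𝒩_{K_n,4M})` `≤ Bᵗ`, both spins, every pin) + `hB1` (off-diagonal
  `(1+|Δx̃₀|+|Δx̃₁|)`-weighted pinned sum `≤ B₁`) + the two conversions `(2·4M/β)·Bᵗ ≤ Z·U²`, `(2·4M/β)·B₁ ≤ S·U²` with `Z, S` inside the all-scales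
  allowance + C1 `hcut` / C2 `hsp` ⇒ `TwoLegStepV17F2 L M G P Q R β U μ n`;
* `stub_twoLeg_step_of_gridMoments_thr7` — the same at the registered GEOMETRY package `G = klEngGeo7` with `Q` still a binder (row `hGS` discharged by
  `klC4aJetC_le_klEngGeo7_S`; the `Q`-rows `klC4aJetC' ≤ Q.S'`, `0 ≤ Q.CL` stay — at `Q = klEngQ7 P R` they are `klC4aJetC'_le_klEngQ7_S'` /
  `klEngQ7_CL_nonneg` of `…ClosersQ7U9`).

So, for the (e) prover of the registered skeleton, residual B is now VERBATIM: two pinned weighted sums of `kernel₂ (W_n[K_n] − 𝒩_{K_n,4M})` of size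
`≤ (β/(2·4M))·{Z, S}·U²` — the native output currency of the decay-weighted determinant/Gram step of the one-shot tower (what p3's `twoLeg_time_sum_le` /
`twoLeg_offDiag_moment_pow_sum_le` deliver at `(0, 0)`).  Proofs only; no definitions; nothing about the model is asserted; nothing asserts
superconductivity.  References: BGM 2006 §2.1 (2.4)–(2.5), §2.3 (2.17), §2.4 (2.36) [cite: BenfattoGiulianiMastropietro2006].
-/

noncomputable section

namespace Summit.HubbardSuperconductivity.HubbardSuperconductivity.Theorems.EngineV8

set_option linter.dupNamespace false -- summit = problem name (single-conjunct summit), D-0017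

open Real Finset Literature.MathematicalPhysics.QuantumLattice Literature.Probability.LatticeModels GrassmannAlgebra
open Literature.MathematicalPhysics.QuantumLattice.FermiRG Literature.MathematicalPhysics.QuantumLattice.BandSectorCounting
open Summit.HubbardSuperconductivity.HubbardSuperconductivity.Theorems.KLProgrammeLegKernels
open Summit.HubbardSuperconductivity.HubbardSuperconductivity.Theorems.DispersionFlow
open Summit.HubbardSuperconductivity.HubbardSuperconductivity.Theorems.PerturbedFermiCurve
open Summit.HubbardSuperconductivity.HubbardSuperconductivity.Theorems.KLRegimeSplit
open Summit.HubbardSuperconductivity.HubbardSuperconductivity.Theorems.TwoPointAssembly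
open Summit.HubbardSuperconductivity.HubbardSuperconductivity.Theorems.TwoLegFourier

/-- `|GridPoint L N| = N·L²` (as reals). -/
theorem card_gridPoint_cast (L N : ℕ) [NeZero L] : (Fintype.card (GridPoint L N) : ℝ) = (N : ℝ) * (L : ℝ) ^ 2 := by
  simp [GridPoint, Fintype.card_prod, Fintype.card_fin, ZMod.card]

/-- The bridge's coefficient on the `4M`-grid: `2·|GridPoint L 4M|/(|β|·L²) = 2·4M/β` (`0 < β`). -/
theorem two_mul_card_gridPoint_div {L M : ℕ} [NeZero L] {β : ℝ} (hβ : 0 < β) :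
    2 * (Fintype.card (GridPoint L (2 * (2 * M))) : ℝ) / (|β| * (L : ℝ) ^ 2) = 2 * ((2 * (2 * M) : ℕ) : ℝ) / β := by
  have hL : (L : ℝ) ^ 2 ≠ 0 := by have := NeZero.ne L; positivity
  rw [card_gridPoint_cast, abs_of_pos hβ, ← mul_assoc, mul_div_mul_right _ _ hL]

/-- **STUB (e) OF 20437 WITH RESIDUAL B IN GRID-MOMENT CURRENCY, package `(G, Q)` and thresholds as binders.**  Package rows `hGS`, `hQS`, `hQCL`; doors
`c₃ ≤ klEngC₃3 P R`, `U₀c ≤ klEngU₀4 P R c`, `U₀c ≤ klE3U₀all R`; the stub's literal binders at `(G, Q)`; then, with `K_n := klFlowFrameU L M β U μ n` and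
`W' := effAction (S_{4M}ᵀ C^{K_n}_{>Λ_n} S_{4M}) (V_{4M} + 𝒩_{K_n,4M}) − 𝒩_{K_n,4M}`: `hBt` (circular temporal first moment of `kernel₂ W'`), `hB1` (off-diagonal
first space moment of `kernel₂ W'`), the conversions `hZ : (2·4M/β)·Bᵗ ≤ Z·U²`, `hS : (2·4M/β)·B₁ ≤ S·U²`, the allowances `hZa`, `hSa`, and C1 `hcut`, C2 `hsp`
⇒ `TwoLegStepV17F2 L M G P Q R β U μ n`. -/
theorem stub_twoLeg_step_of_gridMoments_GQ (G : GeoConsts) (Q : EngConsts) {c₃ U₀c : ℝ} (P : SplitConsts) (R : RenConsts) (c : ℝ)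
    (hGS : ∀ k, klC4aJetC k ≤ G.S k) (hQS : ∀ k, klC4aJetC' P R k ≤ Q.S' k) (hQCL : ∀ (β : ℝ) (n : ℕ), 0 ≤ Q.CL β n)
    (hc₃ : c₃ ≤ klEngC₃3 P R) (hU₀ : U₀c ≤ klEngU₀4 P R c) (hU₀all : U₀c ≤ klE3U₀all R) (hP : P.WF) (hR : R.WF2) (hc : 0 < c) (hc3 : c ≤ c₃)
    (μ : ℝ) (hμ : μ ∈ klWindowC) (U : ℝ) (hU : 0 < U) (hUle : U ≤ U₀c) (β : ℝ) (hβ : klBetaMin ≤ β) (hβc : β ≤ Real.exp (c / U ^ 2))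
    (L M : ℕ) [NeZero L] [NeZero M] (hL : klEngL₃ β U ≤ L) (hM : klEngM₃ β U L ≤ M)
    (n : ℕ) (hn1 : 1 ≤ n) (hn : n ≤ nScales β + 1) (hreg : IsKLRegime U c (-(n : ℤ)))
    (hhist : HistP klPredsV17F2 L M G P Q R β U μ 0 n)
    (hfr : FrameOK R U (nScales β) μ (klFlowFrameU L M β U μ n))
    (hE : EngineBoundsAtV17F2 L M G P Q β U μ n)
    (hJ : TwoLegReadJetBound L M klC4aJetC (klC4aJetC' P R) β U μ (klFlowFrameU L M β U μ n) n)
    {Bt B₁ Z S : ℝ}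
    (hBt : ∀ (σ : Fin 2) (p₀ : GridPoint L (2 * (2 * M))), ∑ p₁ : GridPoint L (2 * (2 * M)),
      β / ((2 * (2 * M) : ℕ) : ℝ) * (circDist (2 * (2 * M)) p₀.1.val p₁.1.val : ℝ) *
        ‖kernel ℂ
          (effAction ℂ ((hubbardGridSub L M β (2 * (2 * M))).transpose *
              hubbardCovAboveCT L M β μ 0 (klFlowFrameU L M β U μ n) (klScale klE0 n) * hubbardGridSub L M β (2 * (2 * M)))
            (hubbardGridInteraction L (2 * (2 * M)) β U + hubbardGridCounterQuadratic L (2 * (2 * M)) β (klFlowFrameU L M β U μ n)) -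
            hubbardGridCounterQuadratic L (2 * (2 * M)) β (klFlowFrameU L M β U μ n)) 2
          (fun i => ((![p₀, p₁] i, σ), i))‖ ≤ Bt)
    (hB1 : ∀ (σ : Fin 2) (p₀ : GridPoint L (2 * (2 * M))), ∑ p₁ : GridPoint L (2 * (2 * M)),
      (if p₁.2 - p₀.2 = 0 then (0 : ℝ) else
        (1 + (((p₁.2 - p₀.2) 0).valMinAbs.natAbs : ℝ) + (((p₁.2 - p₀.2) 1).valMinAbs.natAbs : ℝ)) ^ 1) *
        ‖kernel ℂ
          (effAction ℂ ((hubbardGridSub L M β (2 * (2 * M))).transpose *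
              hubbardCovAboveCT L M β μ 0 (klFlowFrameU L M β U μ n) (klScale klE0 n) * hubbardGridSub L M β (2 * (2 * M)))
            (hubbardGridInteraction L (2 * (2 * M)) β U + hubbardGridCounterQuadratic L (2 * (2 * M)) β (klFlowFrameU L M β U μ n)) -
            hubbardGridCounterQuadratic L (2 * (2 * M)) β (klFlowFrameU L M β U μ n)) 2
          (fun i => ((![p₀, p₁] i, σ), i))‖ ≤ B₁)
    (hZ : 2 * ((2 * (2 * M) : ℕ) : ℝ) / β * Bt ≤ Z * U ^ 2) (hS : 2 * ((2 * (2 * M) : ℕ) : ℝ) / β * B₁ ≤ S * U ^ 2)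
    (hZa : Z ≤ (2 : ℝ) ^ 10 * Real.exp 1 ^ 18 * Real.sqrt (2 * (7 + 1606732)) ^ 4 * klE3Acum R)
    (hSa : S ≤ (2 : ℝ) ^ 11 * Real.exp 1 ^ 18 * Real.sqrt (2 * (7 + 1606732)) ^ 4 * klE3Acum R)
    (hcut : ∀ (Mq : ℕ → ℕ) (L₁ M₁ M₂ : ℕ) [NeZero L₁] [NeZero M₁] [NeZero M₂], L ≤ L₁ → Q.M0 β L₁ ≤ M₁ → Mq L₁ ≤ M₁ → M₁ ≤ M₂ →
      (∀ j < n, histV17F2 L₁ M₁ G P Q R β U μ j ∧ TwoLegSlopes L₁ M₁ R β U μ (klFlowFrameU L₁ M₁ β U μ j) j) →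
      (∀ j < n, histV17F2 L₁ M₂ G P Q R β U μ j ∧ TwoLegSlopes L₁ M₂ R β U μ (klFlowFrameU L₁ M₂ β U μ j) j) →
        ∀ θ : ℝ, |klLocalPart L₁ M₁ β U μ (klFlowFrameU L₁ M₁ β U μ n) n θ -
          klLocalPart L₁ M₂ β U μ (klFlowFrameU L₁ M₂ β U μ n) n θ| ≤ Q.CL β n / 4 / L₁)
    (hsp : ∀ (Mq : ℕ → ℕ) (L₁ L₂ M₂ : ℕ) [NeZero L₁] [NeZero L₂] [NeZero M₂], L ≤ L₁ → L₁ ∣ L₂ → Q.M0 β L₁ ≤ M₂ → Mq L₁ ≤ M₂ →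
      Q.M0 β L₂ ≤ M₂ → Mq L₂ ≤ M₂ →
      (∀ j < n, histV17F2 L₁ M₂ G P Q R β U μ j ∧ TwoLegSlopes L₁ M₂ R β U μ (klFlowFrameU L₁ M₂ β U μ j) j) →
      (∀ j < n, histV17F2 L₂ M₂ G P Q R β U μ j ∧ TwoLegSlopes L₂ M₂ R β U μ (klFlowFrameU L₂ M₂ β U μ j) j) →
        ∀ θ : ℝ, |klLocalPart L₁ M₂ β U μ (klFlowFrameU L₁ M₂ β U μ n) n θ -
          klLocalPart L₂ M₂ β U μ (klFlowFrameU L₂ M₂ β U μ n) n θ| ≤ Q.CL β n / 4 / L₁) :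
    TwoLegStepV17F2 L M G P Q R β U μ n := by
  have hβ0 : 0 < β := lt_of_lt_of_le (by norm_num [klBetaMin]) hβ
  -- B1′: the field strength on the shell (indeed at every torus momentum)
  have hzZ : ∀ k ∈ klShell L μ (klFlowFrameU L M β U μ n) n,
      |klFieldStrength L M β U μ (klFlowFrameU L M β U μ n) n k - 1| ≤ Z * U ^ 2 := fun k _ =>
    (abs_klFieldStrength_sub_one_le_of_grid_time_moment_sub_counter_scale hβ0 U μ (klFlowFrameU L M β U μ n) n k hBt).trans hZ
  -- B2′: the gradient of the separated reading on the tube (indeed at every `q`)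
  have hmS : ∀ q : Momentum, |frameLevel μ (klFlowFrameU L M β U μ n) q| ≤ klScale klE0 n →
      ‖fderiv ℝ (evalM (symInterp L (fun p => klLocSelfEnergyRe L M β U μ (klFlowFrameU L M β U μ n) n p -
        (klFlowFrameU L M β U μ n).eval (latticeMomentum L p)))) q‖ ≤ S * U ^ 2 := fun q _ => by
    have h := twoLeg_sep_fderiv_of_grid_scale hβ0.ne' U μ (klFlowFrameU L M β U μ n) n hB1 q
    rw [two_mul_card_gridPoint_div hβ0] at h
    exact h.trans hS
  exact stub_twoLeg_step_of_engineSizes_GQ G Q P R c hGS hQS hQCL hc₃ hU₀ hU₀all hP hR hc hc3 μ hμ U hU hUle β hβ hβc L M hL hM n hn1 hn hreg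
    hhist hfr hE hJ hZa hSa hzZ hmS hcut hsp

/-- **The same at the registered GEOMETRY package `G = klEngGeo7`, `Q` a binder** (row `hGS` discharged; pass `klC4aJetC'_le_klEngQ7_S'`,
`klEngQ7_CL_nonneg`, `klEngC₃6_le_klEngC₃3`, `klEngU₀9_le_klEngU₀4`, `klEngU₀9_le_klE3U₀all` for the registered `(klEngQ7 P R, klEngC₃6, klEngU₀9)`). -/
theorem stub_twoLeg_step_of_gridMoments_thr7 (Q : EngConsts) {c₃ U₀c : ℝ} (P : SplitConsts) (R : RenConsts) (c : ℝ)
    (hQS : ∀ k, klC4aJetC' P R k ≤ Q.S' k) (hQCL : ∀ (β : ℝ) (n : ℕ), 0 ≤ Q.CL β n)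
    (hc₃ : c₃ ≤ klEngC₃3 P R) (hU₀ : U₀c ≤ klEngU₀4 P R c) (hU₀all : U₀c ≤ klE3U₀all R) (hP : P.WF) (hR : R.WF2) (hc : 0 < c) (hc3 : c ≤ c₃)
    (μ : ℝ) (hμ : μ ∈ klWindowC) (U : ℝ) (hU : 0 < U) (hUle : U ≤ U₀c) (β : ℝ) (hβ : klBetaMin ≤ β) (hβc : β ≤ Real.exp (c / U ^ 2))
    (L M : ℕ) [NeZero L] [NeZero M] (hL : klEngL₃ β U ≤ L) (hM : klEngM₃ β U L ≤ M)
    (n : ℕ) (hn1 : 1 ≤ n) (hn : n ≤ nScales β + 1) (hreg : IsKLRegime U c (-(n : ℤ)))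
    (hhist : HistP klPredsV17F2 L M klEngGeo7 P Q R β U μ 0 n)
    (hfr : FrameOK R U (nScales β) μ (klFlowFrameU L M β U μ n))
    (hE : EngineBoundsAtV17F2 L M klEngGeo7 P Q β U μ n)
    (hJ : TwoLegReadJetBound L M klC4aJetC (klC4aJetC' P R) β U μ (klFlowFrameU L M β U μ n) n)
    {Bt B₁ Z S : ℝ}
    (hBt : ∀ (σ : Fin 2) (p₀ : GridPoint L (2 * (2 * M))), ∑ p₁ : GridPoint L (2 * (2 * M)),
      β / ((2 * (2 * M) : ℕ) : ℝ) * (circDist (2 * (2 * M)) p₀.1.val p₁.1.val : ℝ) *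
        ‖kernel ℂ
          (effAction ℂ ((hubbardGridSub L M β (2 * (2 * M))).transpose *
              hubbardCovAboveCT L M β μ 0 (klFlowFrameU L M β U μ n) (klScale klE0 n) * hubbardGridSub L M β (2 * (2 * M)))
            (hubbardGridInteraction L (2 * (2 * M)) β U + hubbardGridCounterQuadratic L (2 * (2 * M)) β (klFlowFrameU L M β U μ n)) -
            hubbardGridCounterQuadratic L (2 * (2 * M)) β (klFlowFrameU L M β U μ n)) 2
          (fun i => ((![p₀, p₁] i, σ), i))‖ ≤ Bt)
    (hB1 : ∀ (σ : Fin 2) (p₀ : GridPoint L (2 * (2 * M))), ∑ p₁ : GridPoint L (2 * (2 * M)),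
      (if p₁.2 - p₀.2 = 0 then (0 : ℝ) else
        (1 + (((p₁.2 - p₀.2) 0).valMinAbs.natAbs : ℝ) + (((p₁.2 - p₀.2) 1).valMinAbs.natAbs : ℝ)) ^ 1) *
        ‖kernel ℂ
          (effAction ℂ ((hubbardGridSub L M β (2 * (2 * M))).transpose *
              hubbardCovAboveCT L M β μ 0 (klFlowFrameU L M β U μ n) (klScale klE0 n) * hubbardGridSub L M β (2 * (2 * M)))
            (hubbardGridInteraction L (2 * (2 * M)) β U + hubbardGridCounterQuadratic L (2 * (2 * M)) β (klFlowFrameU L M β U μ n)) -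
            hubbardGridCounterQuadratic L (2 * (2 * M)) β (klFlowFrameU L M β U μ n)) 2
          (fun i => ((![p₀, p₁] i, σ), i))‖ ≤ B₁)
    (hZ : 2 * ((2 * (2 * M) : ℕ) : ℝ) / β * Bt ≤ Z * U ^ 2) (hS : 2 * ((2 * (2 * M) : ℕ) : ℝ) / β * B₁ ≤ S * U ^ 2)
    (hZa : Z ≤ (2 : ℝ) ^ 10 * Real.exp 1 ^ 18 * Real.sqrt (2 * (7 + 1606732)) ^ 4 * klE3Acum R)
    (hSa : S ≤ (2 : ℝ) ^ 11 * Real.exp 1 ^ 18 * Real.sqrt (2 * (7 + 1606732)) ^ 4 * klE3Acum R)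
    (hcut : ∀ (Mq : ℕ → ℕ) (L₁ M₁ M₂ : ℕ) [NeZero L₁] [NeZero M₁] [NeZero M₂], L ≤ L₁ → Q.M0 β L₁ ≤ M₁ → Mq L₁ ≤ M₁ → M₁ ≤ M₂ →
      (∀ j < n, histV17F2 L₁ M₁ klEngGeo7 P Q R β U μ j ∧ TwoLegSlopes L₁ M₁ R β U μ (klFlowFrameU L₁ M₁ β U μ j) j) →
      (∀ j < n, histV17F2 L₁ M₂ klEngGeo7 P Q R β U μ j ∧ TwoLegSlopes L₁ M₂ R β U μ (klFlowFrameU L₁ M₂ β U μ j) j) →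
        ∀ θ : ℝ, |klLocalPart L₁ M₁ β U μ (klFlowFrameU L₁ M₁ β U μ n) n θ -
          klLocalPart L₁ M₂ β U μ (klFlowFrameU L₁ M₂ β U μ n) n θ| ≤ Q.CL β n / 4 / L₁)
    (hsp : ∀ (Mq : ℕ → ℕ) (L₁ L₂ M₂ : ℕ) [NeZero L₁] [NeZero L₂] [NeZero M₂], L ≤ L₁ → L₁ ∣ L₂ → Q.M0 β L₁ ≤ M₂ → Mq L₁ ≤ M₂ →
      Q.M0 β L₂ ≤ M₂ → Mq L₂ ≤ M₂ →
      (∀ j < n, histV17F2 L₁ M₂ klEngGeo7 P Q R β U μ j ∧ TwoLegSlopes L₁ M₂ R β U μ (klFlowFrameU L₁ M₂ β U μ j) j) →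
      (∀ j < n, histV17F2 L₂ M₂ klEngGeo7 P Q R β U μ j ∧ TwoLegSlopes L₂ M₂ R β U μ (klFlowFrameU L₂ M₂ β U μ j) j) →
        ∀ θ : ℝ, |klLocalPart L₁ M₂ β U μ (klFlowFrameU L₁ M₂ β U μ n) n θ -
          klLocalPart L₂ M₂ β U μ (klFlowFrameU L₂ M₂ β U μ n) n θ| ≤ Q.CL β n / 4 / L₁) :
    TwoLegStepV17F2 L M klEngGeo7 P Q R β U μ n :=
  stub_twoLeg_step_of_gridMoments_GQ klEngGeo7 Q P R c klC4aJetC_le_klEngGeo7_S hQS hQCL hc₃ hU₀ hU₀all hP hR hc hc3 μ hμ U hU hUle β hβ hβc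
    L M hL hM n hn1 hn hreg hhist hfr hE hJ hBt hB1 hZ hS hZa hSa hcut hsp

end Summit.HubbardSuperconductivity.HubbardSuperconductivity.Theorems.EngineV8

end
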